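import Literature.MathematicalPhysics.QuantumFieldTheory.BalabanImbrieJaffe1984to88.BIJ88Expansion5143Obs
import Literature.MathematicalPhysics.QuantumFieldTheory.BalabanImbrieJaffe1984to88.BIJ88Expansion5143Connected

/-!
# `BalabanImbrieJaffe1984to88.BIJ88Expansion5143KP` — T. Bałaban, J. Imbrie, A. Jaffe, *Effective action and cluster properties of the abelian
Higgs model*, Commun. Math. Phys. **114** (1988) 257–315 [BalabanImbrieJaffe1988]: Sect. 5.14, p. 310 [PDF 54], verbatim: *"We put u = 1 + a and
expand in the usual manner. This enables us to factor out the normalization z_t(Λ^{(k)}_{12}) … It is now a standard exercise to estimate the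
expansion, using (5.14.4)."* — **THE STANDARD EXERCISE FOR THE VACUUM GAS OF THE PRIME-DROPPED EXPANSION (5.14.3)**: the Kotecký–Preiss
condition for the gas of the slot-free polymers `X_β` (`H_β = ∅`) with the prime-dropped activities `g₃′(∅, X_β)` — the hypothesis `hKP` under
which this seat's gen-11 `BIJ88Expansion5143Obs.corner_ratio_eq_sum_prod_Gk` factors out the normalization and writes the second display of
p. 312 — DERIVED from the printed input **(5.14.4)** (p. 309 [PDF 53], verbatim: *"Let us drop the prime, and prove that |g₃(H_β, X_β)| ≤
(e^β(L^kε/ε₀)^{1/4−α})^{[|H_β| + β′|X_β∖H_β|]}. (5.14.4) We use X_β∖H_β to denote the set of cubes with no (d/dt)_{γ_j} factors, j ∈ H_β"*), read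
at `H_β = ∅` (`|g₃(∅, X_β)| ≤ θ^{β′|X_β|}`, `θ` = the vertex factor `e^β(L^kε/ε₀)^{1/4−α}`), plus ONE smallness condition on `θ^{β′}` (p. 310:
*"(We allow adjustments in β, α, β′, keeping them small.)"*).

HONEST FRAMING (cell `lit-balaban`, verbatim): statement-level skeleton of published theorems with citation tags; proofs where landed; nothing here is a claim about the Yang–Mills mass gap.

PDF held: `paper:balaban1988-cmp114-bij-abelian-higgs-effective-action` (journal page = PDF page + 256); p. 309 = PDF 53 (`p0053.txt` L10–14),
p. 310 = PDF 54 (`p0054.txt` L3–4, L26–27), read this session.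

WHAT IS REPRODUCED (unit `lit-balaban-p25`, generation 12 of the Phase-2 proof seat p25; SKELETON rows `C2.Eq5.14.3-5.14.4` ((5.14.4) as the
input), `C2.Claim@310` (the *"standard exercise"* sentence, here for the `g₃` gas) and `C2.Claim@312` (the hypothesis `hKP` of the second display);
HOME `run/shared/lean/pub/lit-balaban/lit-balaban-p25/`). Setting of gen 10/11 (`BIJ88Expansion5143`, `…Ordered`, `…Obs`): cubes `ι` with the
abutting relation `adj`, vacuum polymers `polysOf W` (nonempty `X ⊆ W`), incompatibility = overlap of virtual supports `Ov (cvsupp adj W)` (= the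
cluster-configuration incompatibility `cinc`: equal, overlapping, or both large and abutting), activities `prime (g3 adj z) ∅ X` = `g₃′(∅, X)`.
* §1 TRANSPORT ALONG A RING HOMOMORPHISM (`map_cornerSum`, `map_g1`, `map_g3`, `map_prime`, `isClusterFactorizing_map`, `isSlotLocal_map`) and the
  complexification `fun K X Λ => (zr K X Λ : ℂ)` of REAL corner data (`prime_g3_cpx`, `norm_prime_g3_cpx`, `isClusterFactorizing_cpx`,
  `isSlotLocal_cpx`): the §5.13 Gaussian model instance of gen 10 (`BIJ88Expansion5143Gauss.expansion5143_gauss`, real expectations) feeds the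
  complex polymer-gas files of gen 11 without restatement.
* §2 GEOMETRY: `touches_of_cinc` / `touches_of_ov` (incompatible polymers are equal or TOUCHING — the abutting clause of `cinc` is covered by the
  animal bound at no cost), `isRConnected_of_prime_g3_ne_zero` (p. 309 *"cover and connect"*: `g₃′` lives on `adj`-connected polymers, via gen 10's
  `isConn_of_prime_g3_ne_zero` and `BIJ88Expansion5143Connected.isConn_iff_isRConnected`).
* §3 **`isKPVolume_polysOf`** — the standard exercise from an ACTIVITY BOUND, uniformly in the volume: if `adj` is symmetric of degree `≤ Δ`
  (neighbours listed by `nbr`), the activities vanish off connected polymers and obey `‖w X‖ ≤ ε^{#X}` with `2eε(Δ+1)² ≤ 1`, then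
  `IsKPVolume (Ov (cvsupp adj W)) w (#·) (polysOf W)`: `Σ_{Y incompatible with X} ‖w Y‖e^{#Y} ≤ #X(Δ+1)·2eε ≤ #X` by the lattice-animal bound
  `LatticeModels.PolymerGasGeometric.sum_kpWeight_le_of_touches` (exactly as gen 9's `BIJ88TypedGasKP.isKPVolume_typedGas` for the typed gas of (5.13.4)).
* §4 **FROM (5.14.4)**: `|X_β ∖ H_β| = (X ∖ H.image loc).card` (the cubes of `X` carrying no slot of `H`; `= #X` at `H = ∅`,
  `card_sdiff_image_empty`); `isKPVolume_vacuum_of_norm5144` (complex activities, the `H_β = ∅` instance of (5.14.4) in modulus form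
  `‖g₃′(∅,X)‖ ≤ θ^{β′#X}` as the hypothesis); `norm5144_of_ineq5144` and **`isKPVolume_vacuum_of_ineq5144`** — r16's typed leaf
  `BIJ88Sect5StatementsPart2.Ineq5144 (cubeSys ι) (Finset S) (prime (g3 adj zr)) card (fun H X => (X ∖ H.image loc).card) θ β′` VERBATIM for real
  corner data `zr` ⟹ the KP volume for the complexified vacuum activities; `exists_theta0_kp` (the smallness holds for all `0 ≤ θ ≤ θ₀(Δ, β′)`,
  `β′ > 0` — *"adjustments in β, α, β′"*).
* §5 CONSEQUENCES with `hKP` DISCHARGED modulo (5.14.4): `corner_empty_ne_zero_of_ineq5144` (the normalization `⟨Π_{i∈W} f(□_i)⟩ ≠ 0`),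
  **`corner_ratio_eq_sum_prod_Gk_of_ineq5144`** (THE SECOND DISPLAY OF p. 312 for the corner expectations of (5.14.3) of REAL slot-local
  cluster-factorizing data, from (5.14.4) + smallness + geometry only), `corner_eq_Z_mul_sum_prod_Gk_of_ineq5144`, and the complex/modulus form
  `corner_ratio_eq_sum_prod_Gk_of_norm5144`.
HONEST SCOPE: (a) (5.14.4) itself is NOT proved (typed leaf `Ineq5144`, row C2.Eq5.14.3-5.14.4; its proof is the analytic pp. 307/309 estimate); (b)
only its `H_β = ∅` instance is used — the slot-carrying activities need no smallness for the finite identities of gen 11; (c) the size function is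
`a(X) = #X` and the constants are not optimized (`2eθ^{β′}(Δ+1)² ≤ 1`); (d) no bound on `G_k` (`BIJ88Sect5StatementsPart4.Ineq312`) is asserted.
0 `sorry`, 0 new `Prop` facts (D-0026); imports `BIJ88Expansion5143Obs`, `BIJ88Expansion5143Connected` only; modifies nothing. NOT summit progress;
NOT continuum; NOT Clay. Cell `lit-balaban` Phase 2, seat p25 gen 12 (rows owner r16, referee ref-5).
-/

noncomputable section

open Finset
open Literature.Probability.LatticeModels
open Literature.MathematicalPhysics.QuantumFieldTheory.BalabanImbrieJaffe1984to88.BIJ88Clusters5134 (IsClusterFactorizing cornerSum)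
open Literature.MathematicalPhysics.QuantumFieldTheory.BalabanImbrieJaffe1984to88.BIJ88PolymerRep5134 (g1 IsConn)
open Literature.MathematicalPhysics.QuantumFieldTheory.BalabanImbrieJaffe1984to88.BIJ88VirtualSupports310
open Literature.MathematicalPhysics.QuantumFieldTheory.BalabanImbrieJaffe1984to88.BIJ88Expansion5143
open Literature.MathematicalPhysics.QuantumFieldTheory.BalabanImbrieJaffe1984to88.BIJ88Expansion5143Ordered
open Literature.MathematicalPhysics.QuantumFieldTheory.BalabanImbrieJaffe1984to88.BIJ88Expansion5143Connected (isConn_iff_isRConnected)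
open Literature.MathematicalPhysics.QuantumFieldTheory.BalabanImbrieJaffe1984to88.BIJ88ObservableGas312
open Literature.MathematicalPhysics.QuantumFieldTheory.BalabanImbrieJaffe1984to88.BIJ88SupportRegrouping312
open Literature.MathematicalPhysics.QuantumFieldTheory.BalabanImbrieJaffe1984to88.BIJ88ObservableFactorization312
open Literature.MathematicalPhysics.QuantumFieldTheory.BalabanImbrieJaffe1984to88.BIJ88Expansion5143Obs
open Literature.MathematicalPhysics.QuantumFieldTheory.BalabanImbrieJaffe1984to88.BIJ88Ineq5113Covering (cubeSys)

namespace Literature.MathematicalPhysics.QuantumFieldTheory.BalabanImbrieJaffe1984to88.BIJ88Expansion5143KP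

/-! ## §1 Transport of the corner-form activities along a ring homomorphism; complexification of real corner data -/

section Transport

variable {ι : Type*} [DecidableEq ι] {S : Type*} [DecidableEq S] {R R' : Type*} [CommRing R] [CommRing R'] (f : R →+* R')

/-- a ring homomorphism passes through the alternating corner sum `Σ_{Λ⊆Γ}(−1)^{|Γ∖Λ|}F(1_Λ)` (p. 305: the `Γ`-term of the FTC expansion).
[cite: BalabanImbrieJaffe1988, (5.13.3) p.305] -/
theorem map_cornerSum (F : Finset ι → R) (Γ : Finset ι) : f (cornerSum F Γ) = cornerSum (fun Λ => f (F Λ)) Γ := by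
  simp only [cornerSum, map_sum, map_mul, map_pow, map_neg, map_one]

variable (adj : ι → ι → Prop) [DecidableRel adj]

/-- a ring homomorphism passes through the printed activity `g₁(X)` (a finite signed sum of corner values).
[cite: BalabanImbrieJaffe1988, (5.13.4) p.306] -/
theorem map_g1 (z : Finset ι → Finset ι → R) (X : Finset ι) : f (g1 adj z X) = g1 adj (fun X Λ => f (z X Λ)) X := by
  simp only [g1, map_sum, map_cornerSum]

omit [DecidableEq S] in
/-- a ring homomorphism passes through `g₃(H, X)`. [cite: BalabanImbrieJaffe1988, (5.14.3) p.309] -/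
theorem map_g3 (z : Finset S → Finset ι → Finset ι → R) (H : Finset S) (X : Finset ι) :
    f (g3 adj z H X) = g3 adj (fun K X Λ => f (z K X Λ)) H X :=
  map_g1 f adj (z H) X

omit [DecidableEq ι] in
/-- a ring homomorphism passes through the prime `g₃′ = g₃ − 𝟙[H = ∅, |X| = 1]`. [cite: BalabanImbrieJaffe1988, p.309 (Sect. 5.14)] -/
theorem map_prime (g : Finset S → Finset ι → R) (H : Finset S) (X : Finset ι) :
    f (prime g H X) = prime (fun H X => f (g H X)) H X := by
  unfold prime
  split_ifs <;> simp

variable {adj}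

omit [DecidableRel adj] in
/-- cluster-factorizing corner data stay cluster-factorizing along a ring homomorphism (the four defining identities are equations of ring
elements). [cite: BalabanImbrieJaffe1988, p.306 (Sect. 5.13)] -/
theorem isClusterFactorizing_map {z : Finset ι → Finset ι → R} (hz : IsClusterFactorizing adj z) :
    IsClusterFactorizing adj (fun X Λ => f (z X Λ)) where
  empty Λ := by simp only [hz.empty, map_one]
  local_inter X Λ := congrArg f (hz.local_inter X Λ)
  split X₁ X₂ Λ hd hcut := by simp only [hz.split X₁ X₂ Λ hd hcut, map_mul]
  single i := congrArg f (hz.single i)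

omit [DecidableEq S] in
/-- slot-local corner data stay slot-local along a ring homomorphism. [cite: BalabanImbrieJaffe1988, (5.14.3) p.309] -/
theorem isSlotLocal_map {loc : S → ι} {z : Finset S → Finset ι → Finset ι → R} (hz : IsSlotLocal loc z) :
    IsSlotLocal loc (fun K X Λ => f (z K X Λ)) :=
  fun K X Λ hΛ => congrArg f (hz K X Λ hΛ)

/-! ### Complexification of REAL corner data: the expectations of the §5.13 Gaussian measures are real numbers
(`BIJ88Expansion5143Gauss`), the polymer-gas identities of the tree are stated over `ℂ`; the complexified data are `fun K X Λ => (z K X Λ : ℂ)`. -/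

/-- the prime-dropped activity of the complexified data is the complexified real activity. [cite: BalabanImbrieJaffe1988, p.309 (Sect. 5.14)] -/
theorem prime_g3_cpx (z : Finset S → Finset ι → Finset ι → ℝ) (H : Finset S) (X : Finset ι) :
    prime (g3 adj fun K X Λ => ((z K X Λ : ℝ) : ℂ)) H X = ((prime (g3 adj z) H X : ℝ) : ℂ) := by
  rw [← Complex.ofRealHom_eq_coe, map_prime]
  simp only [map_g3, Complex.ofRealHom_eq_coe]

/-- … so its modulus is the absolute value of the real activity (the `|·|` of (5.14.4)). [cite: BalabanImbrieJaffe1988, (5.14.4) p.309] -/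
theorem norm_prime_g3_cpx (z : Finset S → Finset ι → Finset ι → ℝ) (H : Finset S) (X : Finset ι) :
    ‖prime (g3 adj fun K X Λ => ((z K X Λ : ℝ) : ℂ)) H X‖ = |prime (g3 adj z) H X| := by
  rw [prime_g3_cpx, Complex.norm_real, Real.norm_eq_abs]

omit [DecidableRel adj] in
/-- complexified cluster-factorizing data are cluster-factorizing. [cite: BalabanImbrieJaffe1988, p.306 (Sect. 5.13)] -/
theorem isClusterFactorizing_cpx {z : Finset ι → Finset ι → ℝ} (hz : IsClusterFactorizing adj z) :
    IsClusterFactorizing adj fun X Λ => ((z X Λ : ℝ) : ℂ) :=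
  isClusterFactorizing_map Complex.ofRealHom hz

omit [DecidableEq S] in
/-- complexified slot-local data are slot-local. [cite: BalabanImbrieJaffe1988, (5.14.3) p.309] -/
theorem isSlotLocal_cpx {loc : S → ι} {z : Finset S → Finset ι → Finset ι → ℝ} (hz : IsSlotLocal loc z) :
    IsSlotLocal loc fun K X Λ => ((z K X Λ : ℝ) : ℂ) :=
  isSlotLocal_map Complex.ofRealHom hz

end Transport

/-! ## §2 Geometry: incompatible polymers touch; the prime-dropped activities live on connected polymers -/

section Geometry

variable {ι : Type*} [DecidableEq ι] {S : Type*} [DecidableEq S] {adj : ι → ι → Prop} [DecidableRel adj] {W : Finset ι}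

omit [DecidableEq ι] [DecidableRel adj] in
/-- **incompatible polymers are equal or touching**: the cluster-configuration incompatibility `cinc` (equal, or overlapping, or both of at least two
cubes and abutting) implies the geometric "equal or touching" of the tree's animal bounds (for a symmetric abutting relation).
[cite: BalabanImbrieJaffe1988, p.310 (Sect. 5.14)] -/
theorem touches_of_cinc (hR : ∀ x y, adj x y → adj y x) {X Y : Finset ι} (h : cinc adj Y X) : Y = X ∨ Touches adj X Y := by
  rcases h with h | h | ⟨-, -, a, ha, b, hb, hab⟩
  · exact Or.inl h
  · obtain ⟨c, hcY, hcX⟩ := not_disjoint_iff.1 h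
    exact Or.inr ⟨c, hcX, c, hcY, Or.inl rfl⟩
  · exact Or.inr ⟨b, hb, a, ha, Or.inr (hab.elim (hR a b) id)⟩

omit [DecidableEq S] in
/-- on the polymers of `W`: overlapping virtual supports ⇒ equal or touching. [cite: BalabanImbrieJaffe1988, p.310 (Sect. 5.14)] -/
theorem touches_of_ov (hR : ∀ x y, adj x y → adj y x) {X Y : Finset ι} (hX : X ∈ polysOf W) (hY : Y ∈ polysOf W)
    (h : Ov (cvsupp adj W) Y X) : Y = X ∨ Touches adj X Y :=
  touches_of_cinc hR ((ov_cvsupp_iff hY hX).1 h)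

/-- **`g₃′` lives on connected polymers** (p. 309: *"Each X_γ must cover and connect …"*): a nonempty polymer with `g₃′(H, X) ≠ 0` is
`adj`-path-connected. [cite: BalabanImbrieJaffe1988, p.309 (Sect. 5.14)] -/
theorem isRConnected_of_prime_g3_ne_zero {R : Type*} [CommRing R] (hR : ∀ x y, adj x y → adj y x)
    (z : Finset S → Finset ι → Finset ι → R) (H : Finset S) {X : Finset ι} (hX : X.Nonempty) (h : prime (g3 adj z) H X ≠ 0) :
    IsRConnected adj X :=
  (isConn_iff_isRConnected hR hX).1 (isConn_of_prime_g3_ne_zero z H hX h)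

end Geometry

/-! ## §3 The standard exercise: the Kotecký–Preiss condition for the vacuum gas from an activity bound -/

section KP

variable {ι : Type*} [DecidableEq ι] {adj : ι → ι → Prop} [DecidableRel adj] {nbr : ι → Finset ι} {Δ : ℕ} {W : Finset ι}

omit [DecidableEq ι] [DecidableRel adj] in
/-- **the KP term of a polymer is at most the animal weight**: with the size function `a(X) = #X`, an activity vanishing unless `X` is connected and
bounded by `ε^{#X}` has `‖w X‖e^{#X} ≤ (eε)^{#X}·𝟙[X connected] = kpWeight adj (eε) X`. [cite: BalabanImbrieJaffe1988, p.310 (Sect. 5.14)] -/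
theorem kpTerm_card_le_kpWeight {w : Finset ι → ℂ} {ε : ℝ} {X : Finset ι} (hz0 : ¬ IsRConnected adj X → w X = 0)
    (hz : ‖w X‖ ≤ ε ^ X.card) : kpTerm w (fun X => (X.card : ℝ)) X ≤ kpWeight adj (Real.exp 1 * ε) X := by
  simp only [kpTerm]
  by_cases hc : IsRConnected adj X
  · rw [kpWeight, if_pos hc, mul_pow, Real.exp_one_pow, mul_comm]
    exact mul_le_mul_of_nonneg_left hz (Real.exp_pos _).le
  · rw [kpWeight, if_neg hc, hz0 hc, norm_zero, zero_mul]

omit [DecidableEq ι] [DecidableRel adj] in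
/-- the single printed smallness condition `2eε(Δ+1)² ≤ 1` gives the two constants the animal bound wants. [cite: BalabanImbrieJaffe1988, p.310 (Sect. 5.14)] -/
theorem smallness_split {ε : ℝ} (hε : 0 ≤ ε) (hsmall : 2 * Real.exp 1 * ε * ((Δ : ℝ) + 1) ^ 2 ≤ 1) :
    ((Δ : ℝ) + 1) ^ 2 * (Real.exp 1 * ε) ≤ 1 / 2 ∧ ((Δ : ℝ) + 1) * (2 * (Real.exp 1 * ε)) ≤ 1 := by
  have hΔ0 : (0 : ℝ) ≤ Δ := Nat.cast_nonneg Δ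
  have hlam0 : 0 ≤ Real.exp 1 * ε := mul_nonneg (Real.exp_pos 1).le hε
  refine ⟨by nlinarith [hsmall], ?_⟩
  calc ((Δ : ℝ) + 1) * (2 * (Real.exp 1 * ε)) ≤ ((Δ : ℝ) + 1) ^ 2 * (2 * (Real.exp 1 * ε)) := by
        gcongr
        nlinarith
    _ = 2 * Real.exp 1 * ε * ((Δ : ℝ) + 1) ^ 2 := by ring
    _ ≤ 1 := hsmall

/-- **THE STANDARD EXERCISE FOR THE VACUUM GAS OF (5.14.3) — the Kotecký–Preiss condition from an activity bound, uniformly in the volume**: if the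
abutting relation is symmetric of degree `≤ Δ` (neighbours listed by `nbr`), the vacuum activities on the polymers of `W` vanish off the
`adj`-connected polymers and satisfy `‖w X‖ ≤ ε^{#X}` with `0 ≤ ε` and `2eε(Δ+1)² ≤ 1`, then `polysOf W` is a KP volume for the incompatibility
"overlapping virtual supports" (`= cinc`) and the size function `a(X) = #X`:
`Σ_{Y ∈ polysOf W incompatible with X} ‖w Y‖ e^{#Y} ≤ #X (Δ+1) · 2eε ≤ #X`. [cite: BalabanImbrieJaffe1988, p.310 (Sect. 5.14)] -/
theorem isKPVolume_polysOf (hR : ∀ x y, adj x y → adj y x) (hΔ : ∀ x, (nbr x).card ≤ Δ) (hnbr : ∀ x y, adj x y → y ∈ nbr x)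
    {ε : ℝ} (hε : 0 ≤ ε) (hsmall : 2 * Real.exp 1 * ε * ((Δ : ℝ) + 1) ^ 2 ≤ 1)
    {w : Finset ι → ℂ} (hz0 : ∀ X ∈ polysOf W, ¬ IsRConnected adj X → w X = 0) (hz : ∀ X ∈ polysOf W, ‖w X‖ ≤ ε ^ X.card) :
    IsKPVolume (Ov (cvsupp adj W)) w (fun X => (X.card : ℝ)) (polysOf W) := by
  intro X hX
  set lam : ℝ := Real.exp 1 * ε with hlam
  have hlam0 : 0 ≤ lam := mul_nonneg (Real.exp_pos 1).le hε
  obtain ⟨hsmall₁, hsmall₂⟩ := smallness_split (Δ := Δ) hε hsmall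
  set F : Finset (Finset ι) := (polysOf W).filter fun Y => Ov (cvsupp adj W) Y X with hF
  have h𝒩 : ∀ Y ∈ F, Y = X ∨ Touches adj X Y := fun Y hY =>
    touches_of_ov hR hX (mem_filter.1 hY).1 (mem_filter.1 hY).2
  have hX0 : (0 : ℝ) ≤ X.card := Nat.cast_nonneg _
  show ∑ Y ∈ F, kpTerm w (fun X => (X.card : ℝ)) Y ≤ (X.card : ℝ)
  calc ∑ Y ∈ F, kpTerm w (fun X => (X.card : ℝ)) Y
      ≤ ∑ Y ∈ F, kpWeight adj lam Y :=
        sum_le_sum fun Y hY => kpTerm_card_le_kpWeight (hz0 Y (mem_filter.1 hY).1) (hz Y (mem_filter.1 hY).1)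
    _ ≤ X.card * ((Δ : ℝ) + 1) * (2 * lam) := sum_kpWeight_le_of_touches hR hΔ hnbr hlam0 hsmall₁ X F h𝒩
    _ = X.card * (((Δ : ℝ) + 1) * (2 * lam)) := by ring
    _ ≤ X.card * 1 := by gcongr
    _ = X.card := mul_one _

end KP

/-! ## §4 From (5.14.4): the `H_β = ∅` instance bounds the vacuum activities -/

section Norm5144

variable {ι : Type*} [DecidableEq ι] {S : Type*} [DecidableEq S] {adj : ι → ι → Prop} [DecidableRel adj] {nbr : ι → Finset ι} {Δ : ℕ}
  {W : Finset ι}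

/-! `|X_β ∖ H_β|` — p. 309 [PDF 53], verbatim: *"We use X_β∖H_β to denote the set of cubes with no (d/dt)_{γ_j} factors, j ∈ H_β"*: the number
of cubes of `X` at which no slot of `H` is located, `(X ∖ H.image loc).card` (gen 10's `BIJ88Expansion5143.sdiff_image_slotsIn`: for
`H_β = slotsIn loc K X` it is `(X ∖ K.image loc).card`); at `H = ∅` it is `#X`. -/

omit [DecidableRel adj] [DecidableEq S] in
/-- no slots: every cube of `X_β` is slot-free, `|X_β ∖ ∅| = |X_β|`. [cite: BalabanImbrieJaffe1988, (5.14.4) p.309] -/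
theorem card_sdiff_image_empty (loc : S → ι) (X : Finset ι) : (X \ (∅ : Finset S).image loc).card = X.card := by
  rw [image_empty, sdiff_empty]

/-- **KP FOR THE VACUUM GAS FROM THE `H_β = ∅` INSTANCE OF (5.14.4)** (modulus form, complex corner data): if `‖g₃′(∅, X)‖ ≤ θ^{β′#X}` on the
polymers of `W`, `0 ≤ θ`, `2eθ^{β′}(Δ+1)² ≤ 1`, and the abutting relation is symmetric of degree `≤ Δ`, then `polysOf W` is a KP volume for the
vacuum activities `g₃′(∅, ·)` with `a(X) = #X` — the hypothesis `hKP` of `BIJ88Expansion5143Obs.corner_ratio_eq_sum_prod_Gk`.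
[cite: BalabanImbrieJaffe1988, (5.14.4) p.309, p.310 (Sect. 5.14)] -/
theorem isKPVolume_vacuum_of_norm5144 (hR : ∀ x y, adj x y → adj y x) (hΔ : ∀ x, (nbr x).card ≤ Δ) (hnbr : ∀ x y, adj x y → y ∈ nbr x)
    {θ β' : ℝ} (hθ : 0 ≤ θ) (hsmall : 2 * Real.exp 1 * θ ^ β' * ((Δ : ℝ) + 1) ^ 2 ≤ 1) {z : Finset S → Finset ι → Finset ι → ℂ}
    (h5144 : ∀ X ∈ polysOf W, ‖prime (g3 adj z) ∅ X‖ ≤ θ ^ (β' * (X.card : ℝ))) :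
    IsKPVolume (Ov (cvsupp adj W)) (fun X => prime (g3 adj z) ∅ X) (fun X => (X.card : ℝ)) (polysOf W) := by
  refine isKPVolume_polysOf hR hΔ hnbr (Real.rpow_nonneg hθ β') hsmall (fun X hX hc => ?_) fun X hX => ?_
  · by_contra h
    exact hc (isRConnected_of_prime_g3_ne_zero hR z ∅ (mem_polysOf.1 hX).2 h)
  · rw [← Real.rpow_natCast, ← Real.rpow_mul hθ]
    exact h5144 X hX

/-- **THE THRESHOLD `θ₀(Δ, β′)`** (p. 310: *"(We allow adjustments in β, α, β′, keeping them small.)"*): for `β′ > 0` the smallness condition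
`2eθ^{β′}(Δ+1)² ≤ 1` holds for every vertex factor `0 ≤ θ ≤ θ₀ := (2e(Δ+1)²)^{−1/β′}` — the vertex factor `e^β(L^kε/ε₀)^{1/4−α} → 0` as
`L^kε/ε₀ → 0`. [cite: BalabanImbrieJaffe1988, p.310 (Sect. 5.14)] -/
theorem exists_theta0_kp (Δ : ℕ) {β' : ℝ} (hβ : 0 < β') :
    ∃ θ₀ : ℝ, 0 < θ₀ ∧ ∀ θ : ℝ, 0 ≤ θ → θ ≤ θ₀ → 2 * Real.exp 1 * θ ^ β' * ((Δ : ℝ) + 1) ^ 2 ≤ 1 := by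
  set c : ℝ := 2 * Real.exp 1 * ((Δ : ℝ) + 1) ^ 2 with hc
  have hc0 : 0 < c := by positivity
  refine ⟨(c⁻¹) ^ (1 / β'), by positivity, fun θ hθ hle => ?_⟩
  have hpow : θ ^ β' ≤ c⁻¹ := by
    calc θ ^ β' ≤ ((c⁻¹) ^ (1 / β')) ^ β' := Real.rpow_le_rpow hθ hle hβ.le
      _ = c⁻¹ := by
          rw [← Real.rpow_mul (inv_nonneg.2 hc0.le), one_div_mul_cancel hβ.ne', Real.rpow_one]
  calc 2 * Real.exp 1 * θ ^ β' * ((Δ : ℝ) + 1) ^ 2 = c * θ ^ β' := by rw [hc]; ring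
    _ ≤ c * c⁻¹ := by gcongr
    _ = 1 := mul_inv_cancel₀ hc0.ne'

end Norm5144

/-! ## §4 (continued) and §5: from the typed leaf (5.14.4) of `BIJ88Sect5StatementsPart2`, for REAL corner data; the consequences

`BIJ88Sect5StatementsPart2.PolymerSys.Poly` lives in `Type` (so does `cubeSys`); so do the statements mentioning the leaf. -/

section Leaf

variable {ι : Type} [DecidableEq ι] {S : Type} [DecidableEq S] {adj : ι → ι → Prop} [DecidableRel adj] {nbr : ι → Finset ι} {Δ : ℕ}
  {W : Finset ι} {loc : S → ι}

/-- **(5.14.4) at `H_β = ∅`, verbatim from the typed leaf**: `Ineq5144 (cubeSys ι) (Finset S) (prime (g3 adj zr)) card (fun H X => (X ∖ H.image loc).card) θ β′`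
(the display (5.14.4) for the prime-dropped activities of real corner data `zr`, `|H_β| = card H`, `|X_β∖H_β| = (X ∖ H.image loc).card`) gives
`‖g₃′(∅, X)‖ ≤ θ^{β′#X}` for the complexified activities. [cite: BalabanImbrieJaffe1988, (5.14.4) p.309] -/
theorem norm5144_of_ineq5144 {zr : Finset S → Finset ι → Finset ι → ℝ} {θ β' : ℝ}
    (h : BIJ88Sect5StatementsPart2.Ineq5144 (cubeSys ι) (Finset S) (prime (g3 adj zr)) Finset.card
      (fun H (X : Finset ι) => (X \ H.image loc).card) θ β') (X : Finset ι) :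
    ‖prime (g3 adj fun K X Λ => ((zr K X Λ : ℝ) : ℂ)) ∅ X‖ ≤ θ ^ (β' * (X.card : ℝ)) := by
  rw [norm_prime_g3_cpx]
  have hX := h ∅ X
  simp only [card_empty, Nat.cast_zero, zero_add, card_sdiff_image_empty] at hX
  exact hX

/-- **KP FOR THE VACUUM GAS OF (5.14.3) FROM (5.14.4)** (*"It is now a standard exercise to estimate the expansion, using (5.14.4)"*): for REAL corner
data `zr` whose prime-dropped activities satisfy the typed leaf (5.14.4) with vertex factor `0 ≤ θ` and exponent `β′`, `2eθ^{β′}(Δ+1)² ≤ 1`, and a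
symmetric abutting relation of degree `≤ Δ`, the polymers of EVERY region `W` form a KP volume for the complexified vacuum activities
`g₃′(∅, ·)`, size function `#X`. [cite: BalabanImbrieJaffe1988, (5.14.4) p.309, p.310 (Sect. 5.14)] -/
theorem isKPVolume_vacuum_of_ineq5144 (hR : ∀ x y, adj x y → adj y x) (hΔ : ∀ x, (nbr x).card ≤ Δ) (hnbr : ∀ x y, adj x y → y ∈ nbr x)
    {θ β' : ℝ} (hθ : 0 ≤ θ) (hsmall : 2 * Real.exp 1 * θ ^ β' * ((Δ : ℝ) + 1) ^ 2 ≤ 1) {zr : Finset S → Finset ι → Finset ι → ℝ}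
    (h : BIJ88Sect5StatementsPart2.Ineq5144 (cubeSys ι) (Finset S) (prime (g3 adj zr)) Finset.card
      (fun H (X : Finset ι) => (X \ H.image loc).card) θ β') (W : Finset ι) :
    IsKPVolume (Ov (cvsupp adj W)) (fun X => prime (g3 adj fun K X Λ => ((zr K X Λ : ℝ) : ℂ)) ∅ X) (fun X => (X.card : ℝ)) (polysOf W) :=
  isKPVolume_vacuum_of_norm5144 hR hΔ hnbr hθ hsmall fun X _ => norm5144_of_ineq5144 h X

/-! ### §5 The second display of p. 312 for the corner expectations of (5.14.3), `hKP` discharged modulo (5.14.4) -/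

/-- **the normalization `⟨Π_{i∈W} f(□_i)⟩₁` does not vanish** (p. 310: *"This enables us to factor out the normalization"*) for real slot-local
corner data, cluster-factorizing at `K = ∅`, under (5.14.4) and the smallness of the vertex factor. [cite: BalabanImbrieJaffe1988, p.310, p.312 (Sect. 5.14)] -/
theorem corner_empty_ne_zero_of_ineq5144 (hR : ∀ x y, adj x y → adj y x) (hΔ : ∀ x, (nbr x).card ≤ Δ) (hnbr : ∀ x y, adj x y → y ∈ nbr x)
    {θ β' : ℝ} (hθ : 0 ≤ θ) (hsmall : 2 * Real.exp 1 * θ ^ β' * ((Δ : ℝ) + 1) ^ 2 ≤ 1) {zr : Finset S → Finset ι → Finset ι → ℝ}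
    (hz0 : IsClusterFactorizing adj (zr ∅)) (hloc : IsSlotLocal loc zr)
    (h : BIJ88Sect5StatementsPart2.Ineq5144 (cubeSys ι) (Finset S) (prime (g3 adj zr)) Finset.card
      (fun H (X : Finset ι) => (X \ H.image loc).card) θ β') : zr ∅ W W ≠ 0 := by
  have hne := corner_empty_ne_zero (z := fun K X Λ => ((zr K X Λ : ℝ) : ℂ)) (isClusterFactorizing_cpx hz0) (isSlotLocal_cpx hloc)
    (isKPVolume_vacuum_of_ineq5144 hR hΔ hnbr hθ hsmall h W)
  exact_mod_cast hne

/-- **THE SECOND DISPLAY OF p. 312 FOR THE CORNER EXPECTATIONS OF (5.14.3), FROM (5.14.4)** (p. 310: *"We put u = 1 + a and expand in the usual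
manner. This enables us to factor out the normalization … a standard exercise … using (5.14.4)"*; p. 312: *"= Σ_{{X_{r′}}} Π_{r′} G_k(X_{r′}) … The
X_{r′} are disjoint, and each one covers at least one X_{σ₁}"*): for REAL slot-local corner data `zr`, cluster-factorizing for the slot set `K` and for
`∅`, slots located in `W`, whose prime-dropped activities obey the typed leaf (5.14.4) with a vertex factor `θ` satisfying `2eθ^{β′}(Δ+1)² ≤ 1`
(abutting relation symmetric of degree `≤ Δ`): the normalized expectation `⟨Π_{j∈K}(d/dt)_{γ_j} …⟩ / ⟨…⟩ = Σ_{ρ disjoint, covering the slots, each member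
covering a slot} Π_{X′∈ρ} G_k(X′)` with the `G_k` DEFINED in `BIJ88ObservableFactorization312.Gk` — gen 11's `corner_ratio_eq_sum_prod_Gk` with its
hypothesis `hKP` DISCHARGED. [cite: BalabanImbrieJaffe1988, (5.14.4) p.309, p.310, p.312 (Sect. 5.14)] -/
theorem corner_ratio_eq_sum_prod_Gk_of_ineq5144 (hR : ∀ x y, adj x y → adj y x) (hΔ : ∀ x, (nbr x).card ≤ Δ)
    (hnbr : ∀ x y, adj x y → y ∈ nbr x) {θ β' : ℝ} (hθ : 0 ≤ θ) (hsmall : 2 * Real.exp 1 * θ ^ β' * ((Δ : ℝ) + 1) ^ 2 ≤ 1)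
    {zr : Finset S → Finset ι → Finset ι → ℝ} {K : Finset S} (hzK : IsClusterFactorizing adj (zr K)) (hz0 : IsClusterFactorizing adj (zr ∅))
    (hloc : IsSlotLocal loc zr) (hK : ∀ j ∈ K, loc j ∈ W)
    (h : BIJ88Sect5StatementsPart2.Ineq5144 (cubeSys ι) (Finset S) (prime (g3 adj zr)) Finset.card
      (fun H (X : Finset ι) => (X \ H.image loc).card) θ β') :
    ((zr K W W : ℝ) : ℂ) / ((zr ∅ W W : ℝ) : ℂ) =
      ∑ ρ ∈ disjFamilies (asupp (isuppO (cvsupp adj W)) (itemU (cvsupp adj W) (obsPolys W loc K) (polysOf W))) with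
          (Cov (locv1 loc) K ρ ∧ ∀ X' ∈ ρ, ∃ j ∈ K, locv1 loc j ⊆ X'),
        ∏ X' ∈ ρ, Gk (cvsupp adj W) (cvsupp adj W) (slotsIn loc K) (locv1 loc) K (obsPolys W loc K)
          (fun X => prime (g3 adj fun K X Λ => ((zr K X Λ : ℝ) : ℂ)) (slotsIn loc K X) X) (Ov (cvsupp adj W))
          (fun X => prime (g3 adj fun K X Λ => ((zr K X Λ : ℝ) : ℂ)) ∅ X) (polysOf W) X' :=
  corner_ratio_eq_sum_prod_Gk (z := fun K X Λ => ((zr K X Λ : ℝ) : ℂ)) (isClusterFactorizing_cpx hzK) (isClusterFactorizing_cpx hz0)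
    (isSlotLocal_cpx hloc) hK (isKPVolume_vacuum_of_ineq5144 hR hΔ hnbr hθ hsmall h W)

/-- the un-normalized form: `⟨Π_{j∈K}(d/dt)_{γ_j} …⟩ = ⟨…⟩ · Σ_ρ Π G_k`, from (5.14.4). [cite: BalabanImbrieJaffe1988, (5.14.4) p.309, p.312 (Sect. 5.14)] -/
theorem corner_eq_Z_mul_sum_prod_Gk_of_ineq5144 (hR : ∀ x y, adj x y → adj y x) (hΔ : ∀ x, (nbr x).card ≤ Δ)
    (hnbr : ∀ x y, adj x y → y ∈ nbr x) {θ β' : ℝ} (hθ : 0 ≤ θ) (hsmall : 2 * Real.exp 1 * θ ^ β' * ((Δ : ℝ) + 1) ^ 2 ≤ 1)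
    {zr : Finset S → Finset ι → Finset ι → ℝ} {K : Finset S} (hzK : IsClusterFactorizing adj (zr K)) (hz0 : IsClusterFactorizing adj (zr ∅))
    (hloc : IsSlotLocal loc zr) (hK : ∀ j ∈ K, loc j ∈ W)
    (h : BIJ88Sect5StatementsPart2.Ineq5144 (cubeSys ι) (Finset S) (prime (g3 adj zr)) Finset.card
      (fun H (X : Finset ι) => (X \ H.image loc).card) θ β') :
    ((zr K W W : ℝ) : ℂ) = ((zr ∅ W W : ℝ) : ℂ) *
      ∑ ρ ∈ disjFamilies (asupp (isuppO (cvsupp adj W)) (itemU (cvsupp adj W) (obsPolys W loc K) (polysOf W))) with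
          (Cov (locv1 loc) K ρ ∧ ∀ X' ∈ ρ, ∃ j ∈ K, locv1 loc j ⊆ X'),
        ∏ X' ∈ ρ, Gk (cvsupp adj W) (cvsupp adj W) (slotsIn loc K) (locv1 loc) K (obsPolys W loc K)
          (fun X => prime (g3 adj fun K X Λ => ((zr K X Λ : ℝ) : ℂ)) (slotsIn loc K X) X) (Ov (cvsupp adj W))
          (fun X => prime (g3 adj fun K X Λ => ((zr K X Λ : ℝ) : ℂ)) ∅ X) (polysOf W) X' :=
  corner_eq_Z_mul_sum_prod_Gk (z := fun K X Λ => ((zr K X Λ : ℝ) : ℂ)) (isClusterFactorizing_cpx hzK) (isClusterFactorizing_cpx hz0)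
    (isSlotLocal_cpx hloc) hK (isKPVolume_vacuum_of_ineq5144 hR hΔ hnbr hθ hsmall h W)

end Leaf

section NormForm

variable {ι : Type*} [DecidableEq ι] {S : Type*} [DecidableEq S] {adj : ι → ι → Prop} [DecidableRel adj] {nbr : ι → Finset ι} {Δ : ℕ}
  {W : Finset ι} {loc : S → ι}

/-- the same display for COMPLEX corner data with the `H_β = ∅` instance of (5.14.4) in modulus form as the hypothesis.
[cite: BalabanImbrieJaffe1988, (5.14.4) p.309, p.312 (Sect. 5.14)] -/
theorem corner_ratio_eq_sum_prod_Gk_of_norm5144 (hR : ∀ x y, adj x y → adj y x) (hΔ : ∀ x, (nbr x).card ≤ Δ)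
    (hnbr : ∀ x y, adj x y → y ∈ nbr x) {θ β' : ℝ} (hθ : 0 ≤ θ) (hsmall : 2 * Real.exp 1 * θ ^ β' * ((Δ : ℝ) + 1) ^ 2 ≤ 1)
    {z : Finset S → Finset ι → Finset ι → ℂ} {K : Finset S} (hzK : IsClusterFactorizing adj (z K)) (hz0 : IsClusterFactorizing adj (z ∅))
    (hloc : IsSlotLocal loc z) (hK : ∀ j ∈ K, loc j ∈ W) (h5144 : ∀ X ∈ polysOf W, ‖prime (g3 adj z) ∅ X‖ ≤ θ ^ (β' * (X.card : ℝ))) :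
    z K W W / z ∅ W W =
      ∑ ρ ∈ disjFamilies (asupp (isuppO (cvsupp adj W)) (itemU (cvsupp adj W) (obsPolys W loc K) (polysOf W))) with
          (Cov (locv1 loc) K ρ ∧ ∀ X' ∈ ρ, ∃ j ∈ K, locv1 loc j ⊆ X'),
        ∏ X' ∈ ρ, Gk (cvsupp adj W) (cvsupp adj W) (slotsIn loc K) (locv1 loc) K (obsPolys W loc K)
          (fun X => prime (g3 adj z) (slotsIn loc K X) X) (Ov (cvsupp adj W)) (fun X => prime (g3 adj z) ∅ X) (polysOf W) X' :=
  corner_ratio_eq_sum_prod_Gk hzK hz0 hloc hK (isKPVolume_vacuum_of_norm5144 hR hΔ hnbr hθ hsmall h5144)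

end NormForm

end Literature.MathematicalPhysics.QuantumFieldTheory.BalabanImbrieJaffe1984to88.BIJ88Expansion5143KP
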